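import Literature.NumberTheory.EllipticCurves.DivisionFieldRamificationProofs
import Mathlib.NumberTheory.NumberField.Cyclotomic.Ideal
import HarnessLib

/-!
# Total ramification of `ℚ(ζ_{t^{k+1}})` at `t`, element form: inertia at `t` is transitive on the conjugates of `ζ`

Helper for the crux `ManinOddAtFour` (C2 of route `ManinLocalTwoThree`, item stmt-BirchSwinnertonDyer-22967), line
`kato_shift_two`, stub `stub_notTrivialEisensteinTwo` (E-es-40, odd auxiliary prime `t`).  The lead's Theorem D
(`ManinLocalTwoThreeNotTrivialEisensteinCyclotomic.exists_prime_modEq_one_lFunction_odd_of_inertia_transitive`) takes as its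
only non-elementary input the hypothesis

  `hTR : ∀ ζ, IsPrimitiveRoot ζ (t ^ (M + 1)) → ∀ g : Γ_ℚ, ∃ i ∈ I_𝔓, i • ζ = g • ζ`

for a prime `𝔓` of `\bar ℤ` above `t` — i.e. *the inertia group at `t` acts transitively on the primitive `t^{M+1}`-th roots of
unity*, which is the element form of the total ramification of `t` in `ℚ(ζ_{t^{M+1}})`.  This file proves it
(`exists_mem_inertia_rat_smul_eq_of_isPrimitiveRoot`), unconditionally, from Mathlib's computation of the ramification index of `t`
in a `t^{k+1}`-cyclotomic extension of `ℚ` (`IsCyclotomicExtension.Rat.ramificationIdxIn_eq_of_prime_pow`: `e = t^k (t-1)`), the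
order of the inertia subgroup of a Galois group (`Ideal.card_inertia_eq_ramificationIdxIn`), the degree
`[ℚ(ζ) : ℚ] = φ(t^{k+1})` (`IsCyclotomicExtension.finrank`), and the tree's lifting lemma
`Literature.NumberTheory.EllipticCurves.exists_mem_inertia_restrict_eq` (`DivisionFieldRamificationProofs`: every element of the
inertia group of `𝔓 ∩ 𝓞 L` in `Gal(L/ℚ)` is the restriction of an element of `I_𝔓 ≤ Γ_ℚ`).

Proof: in `L = ℚ(ζ) ⊆ \bar ℚ` the prime `P = 𝔓 ∩ 𝓞 L` lies over `(t)`, its inertia group in `Gal(L/ℚ)` has order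
`e(P | t) = t^k (t-1) = [L : ℚ] = |Gal(L/ℚ)|`, hence is everything; so `g|_L` lies in it and lifts to some `i ∈ I_𝔓`, and
`i ζ = (g|_L) ζ = g ζ`.

BSD is not proved by this file; it discharges one elementary input of one stub of one line of the crux.
-/

set_option autoImplicit false
set_option linter.dupNamespace false

noncomputable section

open scoped Classical IntermediateField

open NumberField IsDedekindDomain Field IntermediateField
  Literature.NumberTheory.EllipticCurves Literature.NumberTheory.GaloisRepresentations

namespace Summit.BirchSwinnertonDyer.BirchSwinnertonDyer.Theorems.ManinLocalTwoThree

section CyclotomicInertia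

/-- Core of the transitivity statement, for a finite Galois `L ⊆ \bar ℚ` which is `t^{k+1}`-cyclotomic over `ℚ` and contains `ζ`.
[cite: Washington1997, Prop. 2.3] -/
theorem exists_mem_inertia_rat_smul_eq_of_isCyclotomicExtension {t : ℕ} [Fact t.Prime] (k : ℕ)
    (L : IntermediateField ℚ (AlgebraicClosure ℚ)) [FiniteDimensional ℚ L] [IsGalois ℚ L]
    [hcyc : IsCyclotomicExtension {t ^ (k + 1)} ℚ L]
    {v : HeightOneSpectrum (𝓞 ℚ)} (hv : (t : 𝓞 ℚ) ∈ v.asIdeal) {𝔓 : Ideal (absIntegers (𝓞 ℚ) ℚ)}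
    (h𝔓 : 𝔓 ∈ v.primesAbove) {ζ : AlgebraicClosure ℚ} (hζL : ζ ∈ L) (g : absoluteGaloisGroup ℚ) :
    ∃ i ∈ 𝔓.inertia (absoluteGaloisGroup ℚ), i • ζ = g • ζ := by
  have ht : t.Prime := Fact.out
  haveI : 𝔓.IsPrime := h𝔓.1
  haveI : 𝔓.LiesOver v.asIdeal := h𝔓.2
  haveI : NeZero (t ^ (k + 1)) := ⟨pow_ne_zero _ ht.ne_zero⟩
  haveI : NumberField L := NumberField.of_module_finite ℚ L
  -- the prime `P = 𝔓 ∩ 𝓞 L` lies over `(t)`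
  set ι := ringOfIntegersToIntegralClosure (k := ℚ) (Ω := AlgebraicClosure ℚ) L with hι
  set P : Ideal (𝓞 L) := 𝔓.comap ι with hP
  haveI hPprime : P.IsPrime := Ideal.comap_isPrime _ 𝔓
  haveI hPv : P.LiesOver v.asIdeal := @comap_ringOfIntegersToIntegralClosure_liesOver ℚ _ L v 𝔓 h𝔓.2
  have ht𝔓 : ((t : ℕ) : absIntegers (𝓞 ℚ) ℚ) ∈ 𝔓 := by
    have h := hv
    rw [h𝔓.2.over, Ideal.mem_under, map_natCast] at h
    exact h
  have htP : ((t : ℕ) : 𝓞 L) ∈ P := by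
    rw [hP, Ideal.mem_comap]
    convert ht𝔓 using 1
    exact map_natCast ι t
  haveI hPover : P.LiesOver (Ideal.span {(t : ℤ)}) := by
    refine ⟨Ideal.IsMaximal.eq_of_le ?_ ?_ ?_⟩
    · haveI : (Ideal.span {(t : ℤ)}).IsPrime :=
        (Ideal.span_singleton_prime (by exact_mod_cast ht.ne_zero)).mpr (Nat.prime_iff_prime_int.mp ht)
      exact IsPrime.to_maximal_ideal (by
        rw [Ne, Ideal.span_singleton_eq_bot]; exact_mod_cast ht.ne_zero)
    · exact Ideal.IsPrime.ne_top inferInstance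
    · rw [Ideal.span_le, Set.singleton_subset_iff, SetLike.mem_coe, Ideal.mem_under]
      have : (algebraMap ℤ (𝓞 L)) (t : ℤ) = ((t : ℕ) : 𝓞 L) := by simp
      rw [this]; exact htP
  -- `#I_P(Gal(L/ℚ)) = φ(t^{k+1}) = #Gal(L/ℚ)`
  have hcardI : Nat.card (P.inertia (L ≃ₐ[ℚ] L)) = t ^ k * (t - 1) := by
    have h1 := Ideal.card_inertia_eq_ramificationIdxIn (G := L ≃ₐ[ℚ] L) (Ideal.span {(t : ℤ)}) P
    rw [h1]
    exact IsCyclotomicExtension.Rat.ramificationIdxIn_eq_of_prime_pow t k L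
  have hcardG : Nat.card (L ≃ₐ[ℚ] L) = t ^ k * (t - 1) := by
    rw [IsGalois.card_aut_eq_finrank, IsCyclotomicExtension.finrank (n := t ^ (k + 1)) L
      (Polynomial.cyclotomic.irreducible_rat (pow_pos ht.pos _)), Nat.totient_prime_pow_succ ht]
  have htop : P.inertia (L ≃ₐ[ℚ] L) = ⊤ := by
    haveI : Finite (L ≃ₐ[ℚ] L) := inferInstance
    exact Subgroup.eq_top_of_card_eq _ (hcardI.trans hcardG.symm)
  -- restrict `g` to `L` and lift inside `I_𝔓`
  set gL : L ≃ₐ[ℚ] L := AlgEquiv.restrictNormal (show AlgebraicClosure ℚ ≃ₐ[ℚ] AlgebraicClosure ℚ from g) L with hgL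
  have hmem : gL ∈ P.inertia (L ≃ₐ[ℚ] L) := by rw [htop]; exact Subgroup.mem_top _
  obtain ⟨σ, hσ, hσg⟩ :=
    @exists_mem_inertia_restrict_eq ℚ _ _ L ‹FiniteDimensional ℚ L› ‹IsGalois ℚ L› 𝔓 ‹𝔓.IsPrime› gL hmem
  refine ⟨σ, hσ, ?_⟩
  have h := hσg ⟨ζ, hζL⟩
  rw [hgL] at h
  have hc := AlgEquiv.restrictNormal_commutes (show AlgebraicClosure ℚ ≃ₐ[ℚ] AlgebraicClosure ℚ from g) L ⟨ζ, hζL⟩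
  -- `algebraMap L \bar ℚ (gL x) = g (algebraMap L \bar ℚ x)`
  exact h.trans hc

/-- **Total ramification of `ℚ(ζ)` at `t`, element form** (`ζ` a primitive `t^{k+1}`-th root of unity in `\bar ℚ`): for a prime
`𝔓` of `\bar ℤ` over `t`, the inertia group `I_𝔓 ≤ Γ_ℚ` acts transitively on the `Γ_ℚ`-conjugates of `ζ` — for every `g ∈ Γ_ℚ`
some `i ∈ I_𝔓` has `i ζ = g ζ`.  (In `L = ℚ(ζ)` the prime below `𝔓` has inertia group of order `e = φ(t^{k+1}) = [L : ℚ]`,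
Mathlib `IsCyclotomicExtension.Rat.ramificationIdxIn_eq_of_prime_pow` + `Ideal.card_inertia_eq_ramificationIdxIn`, so it is all of
`Gal(L/ℚ)`; lift `g|_L` along the tree's `exists_mem_inertia_restrict_eq`.)  This is the input `hTR` of the lead's Theorem D
(`ManinLocalTwoThreeNotTrivialEisensteinCyclotomic`). [cite: Washington1997, Prop. 2.3] -/
theorem exists_mem_inertia_rat_smul_eq_of_isPrimitiveRoot {t : ℕ} (ht : t.Prime) (k : ℕ)
    {v : HeightOneSpectrum (𝓞 ℚ)} (hv : (t : 𝓞 ℚ) ∈ v.asIdeal) {𝔓 : Ideal (absIntegers (𝓞 ℚ) ℚ)}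
    (h𝔓 : 𝔓 ∈ v.primesAbove) {ζ : AlgebraicClosure ℚ} (hζ : IsPrimitiveRoot ζ (t ^ (k + 1))) (g : absoluteGaloisGroup ℚ) :
    ∃ i ∈ 𝔓.inertia (absoluteGaloisGroup ℚ), i • ζ = g • ζ := by
  haveI : Fact t.Prime := ⟨ht⟩
  haveI : Algebra.IsIntegral ℚ (AlgebraicClosure ℚ) := Algebra.isAlgebraic_iff_isIntegral.mp (AlgebraicClosure.isAlgebraic ℚ)
  haveI hcyc : IsCyclotomicExtension {t ^ (k + 1)} ℚ ℚ⟮ζ⟯ := hζ.intermediateField_adjoin_isCyclotomicExtension ℚ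
  haveI : FiniteDimensional ℚ ℚ⟮ζ⟯ := IsCyclotomicExtension.finite {t ^ (k + 1)} ℚ ℚ⟮ζ⟯
  haveI : IsGalois ℚ ℚ⟮ζ⟯ := IsCyclotomicExtension.isGalois {t ^ (k + 1)} ℚ ℚ⟮ζ⟯
  exact exists_mem_inertia_rat_smul_eq_of_isCyclotomicExtension k ℚ⟮ζ⟯ hv h𝔓 (mem_adjoin_simple_self ℚ ζ) g

end CyclotomicInertia

end Summit.BirchSwinnertonDyer.BirchSwinnertonDyer.Theorems.ManinLocalTwoThree

end
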